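import Summits.RiemannHypothesis.RiemannHypothesis.Theorems.IntegerScrewFloorOfRH
import Summits.RiemannHypothesis.RiemannHypothesis.Theorems.IntegerScrewFloorImpliesScrew
import Summits.RiemannHypothesis.RiemannHypothesis.Theorems.IntegerScrewScrewDensityDetection
import Summits.RiemannHypothesis.RiemannHypothesis.Theorems.IntegerScrewScrewConverse
import Literature.NumberTheory.LFunctions.ZetaScrewThm12Proofs
import HarnessLib

/-!
# Route IntegerScrew — STRUCTURE OF THE CRUX `ScrewPolyFloor` (stmt-RiemannHypothesis-15757)

With `FloorOfRH` (RH ⇒ polynomial floor, `floorOfRH_proof`), `FloorImpliesScrew`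
(`floorImpliesScrew_proof`), `ScrewDensityDetection` (`screwDensityDetection_proof`), `ScrewConverse`
(`screwConverse_proof`) and Suzuki2023 Thm 1.2 (`Suzuki2023_thm12_holds`) all PROVED in the tree, the
crux `ScrewPolyFloor` is EQUIVALENT to the route target `IntegerScrewPSD` and to Mathlib's
`RiemannHypothesis`:

`ScrewPolyFloor ⟹ IntegerScrewPSD ⟹ (density) PSD on ℝ ⟹ (Thm 1.2) RH ⟹ (FloorOfRH) ScrewPolyFloor`.

So what remains of the crux is exactly the target (RH-strength by design); nothing RH-free is left
unproved on this line.
-/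

-- `Summit.RiemannHypothesis.RiemannHypothesis.…` duplicates `RiemannHypothesis` BY DESIGN (D-0017).
set_option linter.dupNamespace false

namespace Summit.RiemannHypothesis.RiemannHypothesis.Theorems

open Literature.NumberTheory.LFunctions
open Summit.RiemannHypothesis.RiemannHypothesis.Theses.IntegerScrew

/-- The target implies RH: PSD on log-integer configurations ⇒ PSD on all real configurations
(`ScrewDensityDetection`) ⇒ RH (Suzuki2023 Thm 1.2, `Suzuki2023_thm12_holds`). -/
theorem IntegerScrew.riemannHypothesis_of_integerScrewPSD (hP : IntegerScrewPSD) :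
    _root_.RiemannHypothesis := by
  have hall : ∀ (N : ℕ) (t x : Fin N → ℝ),
      0 ≤ ∑ i, ∑ j, zetaScrewKernel (t i) (t j) * (x i * x j) := screwDensityDetection_proof hP
  have hpsd : Literature.Analysis.Complex.IsPosSemidefKernelOn
      (fun t u : ℝ => (zetaScrewKernel t u : ℂ)) Set.univ :=
    (isPosSemidefKernelOn_zetaScrewKernel_iff Set.univ).2 fun N t x _ => hall N t x
  have h12 : Suzuki2023_thm12 := Suzuki2023_thm12_holds
  exact h12.2 hpsd

/-- The route target is equivalent to the Riemann hypothesis. -/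
theorem IntegerScrew.integerScrewPSD_iff_riemannHypothesis :
    IntegerScrewPSD ↔ _root_.RiemannHypothesis :=
  ⟨IntegerScrew.riemannHypothesis_of_integerScrewPSD, fun hRH => screwConverse_proof hRH⟩

/-- The target implies the crux (through RH and the now-proved floor law `FloorOfRH`). -/
theorem IntegerScrew.screwPolyFloor_of_integerScrewPSD (hP : IntegerScrewPSD) : ScrewPolyFloor :=
  floorOfRH_proof (IntegerScrew.riemannHypothesis_of_integerScrewPSD hP)

/-- **Structure theorem of the crux.** `ScrewPolyFloor ↔ IntegerScrewPSD`: the polynomial floor is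
equivalent to plain positive semidefiniteness on log-integer configurations. -/
theorem IntegerScrew.screwPolyFloor_iff_integerScrewPSD : ScrewPolyFloor ↔ IntegerScrewPSD :=
  ⟨fun h => floorImpliesScrew_proof h, IntegerScrew.screwPolyFloor_of_integerScrewPSD⟩

/-- **`ScrewPolyFloor ↔ RH`.** The crux is exactly RH-strength: RH gives it (`floorOfRH_proof`) and
it gives RH (diagonal/density + Suzuki2023 Thm 1.2). -/
theorem IntegerScrew.screwPolyFloor_iff_riemannHypothesis :
    ScrewPolyFloor ↔ _root_.RiemannHypothesis :=
  ⟨fun h => IntegerScrew.riemannHypothesis_of_integerScrewPSD (floorImpliesScrew_proof h),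
    fun hRH => floorOfRH_proof hRH⟩

end Summit.RiemannHypothesis.RiemannHypothesis.Theorems
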